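import Summits.SmoothPoincare4.SmoothPoincare4.Theorems.AgkCor6Sufficiency.Negative.StablyTrivialTight

/-!
# `AgkCor6Sufficiency` — negative-side support IV: AGK's condition is downward closed in `k`

Companion of `StablyTrivialTight.lean` (crux item `stmt-SmoothPoincare4-10894`, work file
`Cruxes/AgkCor6Sufficiency/Disproof.lean` §7).  The crux is `X → SmoothPoincare4` with
`X = ∀ k, X_k`, `X_k` = "every `(3k, k)` group trisection of the trivial group is stably trivial".
Here: `stabilizeIter_add` (stabilising `a` then `b` times is stabilising `a + b` times, up to the
transport `g + 3(a+b) = (g+3a) + 3b`), the cast bookkeeping `cast_cast` / `stabilize_cast` /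
`stabilizeIter_cast` / `iso_cast_iff`, `isStablyTrivial_of_stabilizeIter` (stable triviality
descends along stabilisation), and the structural consequence `agkCondition_downward`:
`X_{k₀} → X_k` for all `k ≤ k₀`, whence `agkCondition_of_frequently`: "`X_k` for infinitely many
`k`" already gives `X`.  So the crux is equivalent to its version with the formally weaker,
eventual hypothesis — provers may assume AGK's condition only for `k ≥ k₀` of their choice (e.g. the
asymptotic Dunfield–Thurston regime of route `CongruenceShadows`), and no refutation of `X` can come
from small `k` alone.  Nothing here concludes the crux or `X`.

References: A. Abrams, D. Gay, R. Kirby, *Group trisections and smooth 4-manifolds*, Geom. Topol.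
22 (2018), Def. 3 (stabilisation), Cor. 6 (p. 1541).
-/

noncomputable section

namespace Summit.SmoothPoincare4.SmoothPoincare4.Theorems.AgkCor6Sufficiency.Negative

open Literature.Topology.FourManifolds Subgroup

variable {g : ℕ}

/-! ## Casts commute with stabilisation and `Iso` -/

/-- Transport of a transport. [folklore] -/
theorem cast_cast {g g' g'' : ℕ} (K : TrisectionKernels g) (h : g = g') (h' : g' = g'') :
    (K.cast h).cast h' = K.cast (h.trans h') := by
  subst h; subst h'; rfl

/-- Stabilisation commutes with transport. [folklore] -/
theorem stabilize_cast {g g' : ℕ} (K : TrisectionKernels g) (h : g = g') :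
    (K.cast h).stabilize = K.stabilize.cast (by rw [h]) := by
  subst h; rfl

/-- Iterated stabilisation commutes with transport. [folklore] -/
theorem stabilizeIter_cast {g g' : ℕ} (K : TrisectionKernels g) (h : g = g') (n : ℕ) :
    (K.cast h).stabilizeIter n = (K.stabilizeIter n).cast (by rw [h]) := by
  subst h; rfl

/-- `Iso` is transport-invariant (both sides). [folklore] -/
theorem iso_cast_iff {g g' : ℕ} (h : g = g') (A B : TrisectionKernels g) :
    TrisectionKernels.Iso (A.cast h) (B.cast h) ↔ TrisectionKernels.Iso A B := by
  subst h; rfl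

/-- **Stabilising `a` times and then `b` times is stabilising `a + b` times** (up to the transport
`g + 3(a+b) = (g + 3a) + 3b`). [folklore] -/
theorem stabilizeIter_add (K : TrisectionKernels g) (a : ℕ) :
    ∀ b : ℕ, (K.stabilizeIter a).stabilizeIter b = (K.stabilizeIter (a + b)).cast (by omega)
  | 0 => rfl
  | b + 1 => by
    show ((K.stabilizeIter a).stabilizeIter b).stabilize = (K.stabilizeIter (a + b)).stabilize.cast _
    rw [stabilizeIter_add K a b, stabilize_cast]

/-- **Stable triviality descends along stabilisation**: if some stabilisation of `K` is stably
trivial, so is `K`. [folklore] -/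
theorem isStablyTrivial_of_stabilizeIter (K : TrisectionKernels g) (j : ℕ)
    (h : (K.stabilizeIter j).IsStablyTrivial) : K.IsStablyTrivial := by
  obtain ⟨n, m, e, hiso⟩ := h
  rw [stabilizeIter_add] at hiso
  refine ⟨j + n, m, by omega, ?_⟩
  have e' : 3 + 3 * m = g + 3 * (j + n) := by omega
  rw [show (s4Kernels.stabilizeIter m).cast e = ((s4Kernels.stabilizeIter m).cast e').cast (by omega) by
    rw [cast_cast]] at hiso
  exact (iso_cast_iff _ _ _).1 hiso

/-- **AGK's condition is downward closed in `k`.**  If every `(3k₀, k₀)` group trisection of the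
trivial group is stably trivial, then so is every `(3k, k)` one for `k ≤ k₀` (stabilise `k₀ - k`
times).  Consequently the crux's hypothesis may be weakened, for free, to "AGK's condition holds for
infinitely many `k`" / "for all sufficiently large `k`". [cite: AbramsGayKirby2018, Cor. 6 (p. 1541)] -/
theorem agkCondition_downward {k₀ : ℕ}
    (h : ∀ K : TrisectionKernels (3 * k₀), IsGroupTrisection (3 * k₀) k₀ (PUnit : Type) K → K.IsStablyTrivial)
    {k : ℕ} (hk : k ≤ k₀) (K : TrisectionKernels (3 * k))
    (hK : IsGroupTrisection (3 * k) k (PUnit : Type) K) : K.IsStablyTrivial := by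
  obtain ⟨j, rfl⟩ := Nat.exists_eq_add_of_le hk
  have hj := isGroupTrisection_stabilizeIter hK j
  have e : 3 * k + 3 * j = 3 * (k + j) := by omega
  have hst := h _ (isGroupTrisection_cast hj e)
  rw [isStablyTrivial_cast_iff] at hst
  exact isStablyTrivial_of_stabilizeIter K j hst

/-- **Eventual form of AGK's condition suffices**: "for every `k₀` there is `k ≥ k₀` at which AGK's
condition holds" already gives it at every `k`. [folklore] -/
theorem agkCondition_of_frequently
    (h : ∀ k₀ : ℕ, ∃ k, k₀ ≤ k ∧ ∀ K : TrisectionKernels (3 * k),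
      IsGroupTrisection (3 * k) k (PUnit : Type) K → K.IsStablyTrivial)
    (k : ℕ) (K : TrisectionKernels (3 * k)) (hK : IsGroupTrisection (3 * k) k (PUnit : Type) K) :
    K.IsStablyTrivial := by
  obtain ⟨k₁, hk₁, h₁⟩ := h k
  exact agkCondition_downward h₁ hk₁ K hK

end Summit.SmoothPoincare4.SmoothPoincare4.Theorems.AgkCor6Sufficiency.Negative

end
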